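import Literature.NumberTheory.PAdicHodge.AinfRamifiedTorsionLiftAdd
import Literature.NumberTheory.PAdicHodge.AinfRamifiedOmegaPeriod
import Literature.NumberTheory.PAdicHodge.AinfRamifiedOmegaComplete
import Literature.NumberTheory.EllipticCurves.FormalGroupLogHomAbelProofs
import Literature.NumberTheory.EllipticCurves.FormalLogExpBaseChangeProofs
import HarnessLib

/-!
# The ω-period over the ramified base is additive: `∫_{t ⊕ t'} ω = ∫_t ω + ∫_{t'} ω` in `B_dR⁺(F)`

Topic `Literature/NumberTheory/PAdicHodge`; the ramified twin (`𝒪 = 𝒪_D = ℤ_p[X]/(f)`, `W/𝒪_D`) of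
`AinfWeierstrassOmegaPeriodAdd` (`𝒪 = ℤ_p`, `W/ℤ`). Assembly of `AinfRamifiedTorsionLiftAdd` (`[t ⊕ t'] = [t] ⊕_W [t']` in
`Ŵ(𝔫) ⊂ A_inf(𝒪)`, a `(p, ω)`-adic statement), `AinfRamifiedOmegaPeriod` (`∫_t ω = log_W(ι_𝒪[t]) ∈ Fil¹B_dR⁺`, a `ξ`-adic
evaluation over the discrete coefficient FIELD `FieldCoeff`), `AinfRamifiedOmegaComplete` (`A_inf(𝒪)` is `ω`-adically
complete Hausdorff) and the tree's `formalLog_subst_formalGroupLaw` (AEC IV.5.2). Over the ramified base the bridge between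
the two topologies must be the `ω`-ADIC topology of `A_inf(𝒪)` (`ker θ_𝒪 = ω A_inf(𝒪)`; the `ξ`-adic one is too coarse on
`A_inf(𝒪)`, where `ξ = ω · c` with `c` a non-unit when `e > 1`):

* §1 `AinfRamXiTop D` — `A_inf(𝒪)` with its `ω`-adic topology, `kerTheta = (ω)` as a `LubinTate.NilIdeal`, the `𝒪_D`-algebra
  structure, and the two CONTINUOUS identity-like maps `toTop : AinfRamXiTop → AinfRamTop` (`(ω) ⊆ 𝔦 = (p, ω)`) and
  `toBdR : AinfRamXiTop → BdRPlusTop` (`ι_𝒪(ω) ∈ ξ_dR · (B_dR⁺)ˣ`);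
* §2 `toTop_evalPt`, `toBdR_evalPt` — for points of `ker θ_𝒪`, evaluation of an `𝒪_D`-power series computed `(p, ω)`-adically
  in `A_inf(𝒪)`, `ω`-adically in `A_inf(𝒪)`, or `ξ`-adically in `B_dR⁺` (after the change of coefficients
  `CoeffDisc.toFieldCoeff : 𝒪_D → F`) agree; hence **`toBdR_evalPt_of_symm`**: `ι_𝒪 : A_inf(𝒪) → B_dR⁺` commutes with
  evaluation at points of `ker θ_𝒪`;
* §3 **`omegaPeriod_addSeq : ∫_{t ⊕ t'} ω = ∫_t ω + ∫_{t'} ω`** — with `gal_omegaPeriod` this makes `t ↦ ∫_t ω` a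
  `Γ_F`-equivariant additive map `T_pŴ(𝒪_{ℂ_F}) → Fil¹B_dR⁺(F)` for `W` over `𝒪_D` (Fontaine 1982 §5; Colmez 1992 §2).

Definitions (reviewed): `AinfRamXiTop` (+ instances), `AinfRamXiTop.of`, `kerTheta`, `toTop`, `toTopAlgHom`, `toBdR`,
`EisensteinRoot.CoeffDisc.toFieldCoeff`. No named facts, no `sorry`. Written for the sub-unit (R1) of crux K★
(`Cruxes/StarredOptimalManinUnitFiveSeven/Lines/kato-lever-hDR-R1-models-descent.md`); nothing about elliptic curves over
number fields (in particular nothing about BSD) is proved here.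

## References
* J.-M. Fontaine, *Formes différentielles et modules de Tate des variétés abéliennes sur les corps locaux*,
  Invent. Math. 65 (1982), §5. [Fontaine1982FormesDifferentielles]
* J.-M. Fontaine, *Le corps des périodes p-adiques*, Astérisque 223 (1994), Exp. II §1.3, §1.5. [FontaineAsterisque223III]
* L. Fargues, J.-M. Fontaine, *Courbes et fibrés vectoriels en théorie de Hodge p-adique*, Astérisque 406 (2018), §2.2.
  [FarguesFontaine2018]
* J. H. Silverman, *The Arithmetic of Elliptic Curves* (2009), IV.5.2. [SilvermanAEC2009]
-/

noncomputable section

open Ideal Field WittVector MvPowerSeries ValuativeRel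

namespace Literature.NumberTheory.PAdicHodge

open Literature.NumberTheory.GaloisRepresentations
open Literature.NumberTheory.GaloisRepresentations.IsNonarchimedeanLocalField
open Literature.NumberTheory.GaloisRepresentations.LubinTate

variable {F : Type} [Field F] [ValuativeRel F] [TopologicalSpace F] [IsNonarchimedeanLocalField F] [CharZero F]
  {p : ℕ} [Fact p.Prime] [Fact (¬ IsUnit (p : integerC F))] {hp : valuation F p < 1}

/-! ## §1 `A_inf(𝒪)` with the `ω`-adic topology -/

/-- **`A_inf(𝒪)` with its `ω`-adic (`ker θ_𝒪`-adic) topology** (type synonym of `AinfRam D`).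
[cite: FontaineAsterisque223III, Exp. II §1.3] [cite: FarguesFontaine2018, §2.2] -/
def AinfRamXiTop (D : EisensteinRoot F p hp) : Type := AinfRam D

namespace AinfRamXiTop

variable (D : EisensteinRoot F p hp)

/-- Ring structure (that of `A_inf(𝒪)`). [folklore] -/
instance : CommRing (AinfRamXiTop D) := inferInstanceAs (CommRing (AinfRam D))

/-- The preferred ideal `(ω) = ker θ_𝒪`. [cite: FarguesFontaine2018, §2.2 (Cor. 2.2.8)] -/
instance : WithIdeal (AinfRamXiTop D) := ⟨(Ideal.span {AinfRam.omega D} : Ideal (AinfRam D))⟩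

/-- The identification `A_inf(𝒪) = AinfRamXiTop` (identity). [folklore] -/
def of : AinfRam D ≃+* AinfRamXiTop D := RingEquiv.refl _

/-- The defining ideal is `(ω)`. [cite: FarguesFontaine2018, §2.2 (Cor. 2.2.8)] -/
theorem ideal_eq : (WithIdeal.i : Ideal (AinfRamXiTop D)) = Ideal.span {of D (AinfRam.omega D)} := rfl

/-- The topology is the `ω`-adic one. [cite: FontaineAsterisque223III, Exp. II §1.3] -/
theorem isAdic : IsAdic (WithIdeal.i : Ideal (AinfRamXiTop D)) := rfl

/-- `(ω)` is closed (an open subgroup). [cite: FontaineAsterisque223III, Exp. II §1.3] -/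
theorem isClosed_ideal : IsClosed ((WithIdeal.i : Ideal (AinfRamXiTop D)) : Set (AinfRamXiTop D)) := by
  have h1 : ((WithIdeal.i ^ 1 : Ideal (AinfRamXiTop D)) : Set (AinfRamXiTop D)) ∈ nhds (0 : AinfRamXiTop D) :=
    (Ideal.hasBasis_nhds_zero_adic (WithIdeal.i : Ideal (AinfRamXiTop D))).mem_of_mem trivial
  rw [pow_one] at h1
  exact (⟨(WithIdeal.i : Ideal (AinfRamXiTop D)).toAddSubgroup,
    (WithIdeal.i : Ideal (AinfRamXiTop D)).toAddSubgroup.isOpen_of_mem_nhds h1⟩ : OpenAddSubgroup (AinfRamXiTop D)).isClosed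

/-- **`ker θ_𝒪 = (ω)` as a closed nil ideal of the `ω`-adic ring `A_inf(𝒪)`.** [cite: FarguesFontaine2018, §2.2 (Cor. 2.2.8)] -/
def kerTheta : NilIdeal (AinfRamXiTop D) where
  toIdeal := WithIdeal.i
  isClosed := isClosed_ideal D
  isTopologicallyNilpotent _ ha := WithIdeal.isTopologicallyNilpotent_of_mem ha

/-- `AinfRamXiTop → AinfRamTop` (the identity of `A_inf(𝒪)`; `ω`-adic to `(p, ω)`-adic). [cite: FontaineAsterisque223III, Exp. II §1.3] -/
def toTop : AinfRamXiTop D →+* AinfRamTop D := (AinfRamTop.of D).toRingHom.comp (of D).symm.toRingHom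

/-- **`toTop` is continuous** (`(ω)ⁿ ⊆ (p, ω)ⁿ`). [cite: FontaineAsterisque223III, Exp. II §1.3] -/
theorem continuous_toTop : Continuous (toTop D) := by
  refine (WithIdeal.uniformContinuous_of_map_le ?_).continuous
  rw [ideal_eq, Ideal.map_span, Ideal.span_le, Set.image_singleton, Set.singleton_subset_iff, SetLike.mem_coe]
  exact AinfRamTop.of_omega_mem_ideal D

/-- **`A_inf(𝒪)` (ω-adic) is an `𝒪_D`-algebra** through `coeffHom : 𝒪_D → A_inf(𝒪)` (the same map as for `AinfRamTop`).
[cite: FarguesFontaine2018, §1.2] -/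
instance algCoeffDisc : Algebra (EisensteinRoot.CoeffDisc D) (AinfRamXiTop D) :=
  ((of D).toRingHom.comp ((AinfRam.coeffHom D).comp (EisensteinRoot.CoeffDisc.of D).symm.toRingHom)).toAlgebra

/-- Unfolding the algebra map `𝒪_D → A_inf(𝒪)` (ω-adic copy). [cite: FarguesFontaine2018, §1.2] -/
theorem algebraMap_coeffDisc (x : D.Coeff) :
    algebraMap (EisensteinRoot.CoeffDisc D) (AinfRamXiTop D) (EisensteinRoot.CoeffDisc.of D x) = of D (AinfRam.coeffHom D x) := rfl

/-- The discrete coefficient ring acts continuously on the ω-adic `A_inf(𝒪)`. [folklore] -/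
instance contSMulCoeffDisc : ContinuousSMul (EisensteinRoot.CoeffDisc D) (AinfRamXiTop D) := by
  refine ⟨continuous_prod_of_discrete_left.mpr fun a => ?_⟩
  change Continuous fun s : AinfRamXiTop D => algebraMap (EisensteinRoot.CoeffDisc D) (AinfRamXiTop D) a * s
  exact continuous_const_mul _

/-- `toTop` as an `𝒪_D`-algebra homomorphism (it is the identity on `𝒪_D`). [cite: FarguesFontaine2018, §1.2] -/
def toTopAlgHom : AinfRamXiTop D →ₐ[EisensteinRoot.CoeffDisc D] AinfRamTop D :=
  { toTop D with commutes' := fun _ => rfl }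

/-- Unfolding `toTopAlgHom`. [cite: FarguesFontaine2018, §1.2] -/
theorem toTopAlgHom_apply (z : AinfRamXiTop D) : toTopAlgHom D z = toTop D z := rfl

variable [IsAdicComplete (Ideal.span {(p : integerC F)}) (integerC F)]

/-- `A_inf(𝒪)` is `ω`-adically complete (tree `AinfRam.isAdicComplete_span_omega`; the surjectivity of Fontaine's `θ` it needs
holds for every `p`-adic field, `surjective_fontaineTheta_integerC`). [cite: FarguesFontaine2018, §2.2] -/
instance : CompleteSpace (AinfRamXiTop D) :=
  ((isAdic D).isAdicComplete_iff.1 (AinfRam.isAdicComplete_span_omega D (surjective_fontaineTheta_integerC hp))).1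

/-- `A_inf(𝒪)` is `ω`-adically Hausdorff. [cite: FarguesFontaine2018, §2.2] -/
instance : T2Space (AinfRamXiTop D) :=
  ((isAdic D).isAdicComplete_iff.1 (AinfRam.isAdicComplete_span_omega D (surjective_fontaineTheta_integerC hp))).2

/-- `AinfRamXiTop → BdRPlusTop` (`ι_𝒪 : A_inf(𝒪) → B_dR⁺`). [cite: FontaineAsterisque223III, Exp. II §1.5.2] -/
def toBdR (hθ : Function.Surjective (fontaineTheta (integerC F) p)) : AinfRamXiTop D →+* BdRPlusTop F p :=
  (BdRPlusTop.of F p).toRingHom.comp ((AinfRam.toBdR D hθ).comp (of D).symm.toRingHom)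

variable {D}
variable {hθ : Function.Surjective (fontaineTheta (integerC F) p)}

/-- Unfolding `toBdR`. [cite: FontaineAsterisque223III, Exp. II §1.5.2] -/
theorem toBdR_of (x : AinfRam D) : toBdR D hθ (of D x) = BdRPlusTop.of F p (AinfRam.toBdR D hθ x) := rfl

variable (D hθ) in
/-- **`toBdR` is continuous** (`ι_𝒪(ω) = ξ_dR · unit`). [cite: FontaineAsterisque223III, Exp. II §1.5.2] [cite: FarguesFontaine2018, §2.2] -/
theorem continuous_toBdR : Continuous (toBdR D hθ) := by
  refine (WithIdeal.uniformContinuous_of_map_le ?_).continuous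
  rw [ideal_eq, Ideal.map_span, Ideal.span_le, Set.image_singleton, Set.singleton_subset_iff, SetLike.mem_coe,
    BdRPlusTop.ideal_eq, toBdR_of]
  obtain ⟨v, hv⟩ := AinfRam.exists_unit_toBdR_omega_eq D hθ
  rw [hv, map_mul]
  exact Ideal.mul_mem_right _ _ (Ideal.mem_span_singleton_self _)

variable (hθ) in
/-- `toBdR` on constants: `ι_𝒪(a · 1) = a · 1` for `a ∈ 𝒪_D` (`𝒪_D → F ↪ B_dR⁺`). [cite: FontaineAsterisque223III, Exp. II §1.5.3] -/
theorem toBdR_algebraMap (x : D.Coeff) :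
    toBdR D hθ (algebraMap (EisensteinRoot.CoeffDisc D) (AinfRamXiTop D) (EisensteinRoot.CoeffDisc.of D x)) =
      algebraMap (FieldCoeff hp hθ) (BdRPlusTop F p) (FieldCoeff.of hp hθ (EisensteinRoot.Coeff.toF D x)) := by
  rw [algebraMap_coeffDisc, toBdR_of, AinfRam.toBdR_coeffHom, FieldCoeff.algebraMap_of]

end AinfRamXiTop

namespace EisensteinRoot

/-- **The change of coefficients `𝒪_D → F`** (`X ↦ ϖ`) into the discrete coefficient field of `B_dR⁺`-evaluation.
[cite: SerreLocalFields1979, Ch. I §6 Prop. 18] -/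
def CoeffDisc.toFieldCoeff (D : EisensteinRoot F p hp) [IsAdicComplete (Ideal.span {(p : integerC F)}) (integerC F)]
    (hθ : Function.Surjective (fontaineTheta (integerC F) p)) : CoeffDisc D →+* FieldCoeff hp hθ :=
  (FieldCoeff.of hp hθ).toRingHom.comp (CoeffDisc.toF D)

/-- Unfolding `toFieldCoeff`. [cite: SerreLocalFields1979, Ch. I §6 Prop. 18] -/
theorem CoeffDisc.toFieldCoeff_of (D : EisensteinRoot F p hp) [IsAdicComplete (Ideal.span {(p : integerC F)}) (integerC F)]
    (hθ : Function.Surjective (fontaineTheta (integerC F) p)) (x : D.Coeff) :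
    CoeffDisc.toFieldCoeff D hθ (CoeffDisc.of D x) = FieldCoeff.of hp hθ (Coeff.toF D x) := rfl

end EisensteinRoot

namespace AinfRamXiTop

variable [IsAdicComplete (Ideal.span {(p : integerC F)}) (integerC F)] {D : EisensteinRoot F p hp}
  {hθ : Function.Surjective (fontaineTheta (integerC F) p)}

/-! ## §2 Evaluation at points of `ker θ_𝒪` in the three topologies -/

/-- **`(p, ω)`-adic and `ω`-adic evaluation agree on `ker θ_𝒪`**: for an `𝒪_D`-power series `f` without constant term and
points `xᵢ ∈ (ω)`, `toTop (f(x)) = f(toTop x)`. [cite: FontaineAsterisque223III, Exp. II §1.3] -/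
theorem toTop_evalPt {ι : Type*} [Finite ι] (f : MvPowerSeries ι (EisensteinRoot.CoeffDisc D)) (hf : f.constantCoeff = 0)
    (x : ι → (kerTheta D).toIdeal) (y : ι → (AinfRamTop.nilTheta D hθ).toIdeal) (hxy : ∀ i, toTop D (x i) = y i) :
    toTop D (evalPt (kerTheta D) f hf x : AinfRamXiTop D) = (evalPt (AinfRamTop.nilTheta D hθ) f hf y : AinfRamTop D) := by
  rw [coe_evalPt, coe_evalPt, ← toTopAlgHom_apply]
  have h := MvPowerSeries.comp_aeval ((kerTheta D).hasEval x) (ε := toTopAlgHom D) (continuous_toTop D)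
  have h' := AlgHom.congr_fun h f
  rw [AlgHom.comp_apply] at h'
  rw [h']
  exact aeval_congr_point _ _ (funext hxy) f

/-- **`ω`-adic evaluation in `A_inf(𝒪)` and `ξ`-adic evaluation in `B_dR⁺` agree** after the change of coefficients
`𝒪_D → F`: `toBdR (f(x)) = fᶠ(toBdR x)` (termwise: `toBdR` is a continuous ring map compatible with the coefficient maps).
[cite: FontaineAsterisque223III, Exp. II §1.5.2] -/
theorem toBdR_evalPt {ι : Type*} [Finite ι] (f : MvPowerSeries ι (EisensteinRoot.CoeffDisc D)) (hf : f.constantCoeff = 0)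
    (hf' : (MvPowerSeries.map (EisensteinRoot.CoeffDisc.toFieldCoeff D hθ) f).constantCoeff = 0)
    (x : ι → (kerTheta D).toIdeal) (z : ι → (BdRPlusTop.filOne F p).toIdeal) (hxz : ∀ i, toBdR D hθ (x i) = z i) :
    toBdR D hθ (evalPt (kerTheta D) f hf x : AinfRamXiTop D) =
      (evalPt (BdRPlusTop.filOne F p) (MvPowerSeries.map (EisensteinRoot.CoeffDisc.toFieldCoeff D hθ) f) hf' z : BdRPlusTop F p) := by
  classical
  rw [coe_evalPt, coe_evalPt]
  have h1 := (hasSum_aeval ((kerTheta D).hasEval x) f).map (toBdR D hθ) (continuous_toBdR D hθ)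
  have h2 := hasSum_aeval ((BdRPlusTop.filOne F p).hasEval z)
    (MvPowerSeries.map (EisensteinRoot.CoeffDisc.toFieldCoeff D hθ) f)
  refine h1.unique ?_
  convert h2 using 1
  funext d
  obtain ⟨c, hc⟩ := (EisensteinRoot.CoeffDisc.of D).surjective (MvPowerSeries.coeff d f)
  simp only [Function.comp_apply, MvPowerSeries.coeff_map, Algebra.smul_def, map_mul, map_finsuppProd, map_pow, hxz, ← hc,
    toBdR_algebraMap, EisensteinRoot.CoeffDisc.toFieldCoeff_of]

omit [CharZero F] [Fact (¬ IsUnit (p : integerC F))] [IsAdicComplete (Ideal.span {(p : integerC F)}) (integerC F)] in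
/-- Constant coefficient after a change of coefficients. [cite: SilvermanAEC2009, IV.2.3] -/
theorem constantCoeff_map_eq_zero {R S : Type*} [CommRing R] [CommRing S] (φ : R →+* S) {ι : Type*} {f : MvPowerSeries ι R}
    (hf : f.constantCoeff = 0) : (MvPowerSeries.map φ f).constantCoeff = 0 := by
  rw [MvPowerSeries.constantCoeff_map, hf, map_zero]

/-- **`ι_𝒪 : A_inf(𝒪) → B_dR⁺` commutes with evaluation at points of `ker θ_𝒪`**: for points `yᵢ ∈ 𝔫` with `θ_𝒪(yᵢ) = 0`
(`yᵢ ∈ ω A_inf(𝒪)`), `ι_𝒪(f(y)) = fᶠ(ι_𝒪 y)` where the left evaluation is `(p, ω)`-adic in `A_inf(𝒪)` and the right one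
`ξ`-adic in `B_dR⁺`. [cite: FontaineAsterisque223III, Exp. II §1.5.2] -/
theorem toBdR_evalPt_of_symm {ι : Type*} [Finite ι] (f : MvPowerSeries ι (EisensteinRoot.CoeffDisc D)) (hf : f.constantCoeff = 0)
    (hf' : (MvPowerSeries.map (EisensteinRoot.CoeffDisc.toFieldCoeff D hθ) f).constantCoeff = 0)
    (y : ι → (AinfRamTop.nilTheta D hθ).toIdeal) (hy : ∀ i, (AinfRamTop.of D).symm (y i) ∈ Ideal.span {AinfRam.omega D})
    (z : ι → (BdRPlusTop.filOne F p).toIdeal)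
    (hyz : ∀ i, BdRPlusTop.of F p (AinfRam.toBdR D hθ ((AinfRamTop.of D).symm (y i))) = z i) :
    BdRPlusTop.of F p (AinfRam.toBdR D hθ ((AinfRamTop.of D).symm (evalPt (AinfRamTop.nilTheta D hθ) f hf y : AinfRamTop D))) =
      (evalPt (BdRPlusTop.filOne F p) (MvPowerSeries.map (EisensteinRoot.CoeffDisc.toFieldCoeff D hθ) f) hf' z : BdRPlusTop F p) := by
  set x : ι → (kerTheta D).toIdeal := fun i => ⟨of D ((AinfRamTop.of D).symm (y i)), hy i⟩ with hx
  rw [← toTop_evalPt f hf x y (fun i => rfl), ← toBdR_evalPt f hf hf' x z (fun i => hyz i)]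
  rfl

end AinfRamXiTop

/-! ## §3 Additivity of the ω-period over the ramified base -/

namespace AinfRamTop

variable [IsAdicComplete (Ideal.span {(p : integerC F)}) (integerC F)] {D : EisensteinRoot F p hp}
  {hθ : Function.Surjective (fontaineTheta (integerC F) p)} (W : WeierstrassCurve (EisensteinRoot.CoeffDisc D))

/-- **`[t] ∈ ω A_inf(𝒪) = ker θ_𝒪`** (`θ_𝒪([t]) = t₀ = 0`). [cite: FarguesFontaine2018, §2.2 (Cor. 2.2.8)] -/
theorem torsionLift_mem_span_omega {t : ℕ → (maxNilIdealC F).toIdeal} (ht0 : (t 0 : CBall F) = 0)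
    (htp : ∀ n, mulPC W (t (n + 1)) = t n) :
    (of D).symm (torsionLift W hθ t htp) ∈ Ideal.span {AinfRam.omega D} := by
  refine Ideal.mem_span_singleton.2 (AinfRam.omega_dvd_of_theta_eq_zero D ?_)
  have h := theta_torsionLift W (hθ := hθ) ht0 htp
  have h' := congrArg (fun z : CBall F => (z : CompletedAlgClosure F)) h
  simp only [ZeroMemClass.coe_zero] at h'
  exact Subtype.ext h'

/-- `log_W` over `FieldCoeff` is the formal logarithm of the base-changed equation `W ×_{𝒪_D} F`. [cite: SilvermanAEC2009, IV.5.5] -/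
theorem logSeries_eq_formalLog : logSeries hθ W = (W.map (EisensteinRoot.CoeffDisc.toFieldCoeff D hθ)).formalLog := by
  rw [logSeries, WeierstrassCurve.map_formalLog, WeierstrassCurve.map_map]
  rfl

/-- The chord–tangent law over `FieldCoeff` is the base change of the one over `𝒪_D`. [cite: SilvermanAEC2009, IV.2.3] -/
theorem map_formalGroupLaw_fieldCoeff :
    MvPowerSeries.map (EisensteinRoot.CoeffDisc.toFieldCoeff D hθ) W.formalGroupLaw =
      (W.map (EisensteinRoot.CoeffDisc.toFieldCoeff D hθ)).formalGroupLaw :=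
  WeierstrassCurve.map_formalGroupLaw _ _

/-- `[t]`, `[t']` and the sum, read in `Fil¹ B_dR⁺`: `ι_𝒪[t ⊕ t'] = Fᶠ(ι_𝒪[t], ι_𝒪[t'])` (`ξ`-adic evaluation of the
base-changed law in `B_dR⁺`). [cite: FontaineAsterisque223III, Exp. II §1.5.2] -/
theorem coe_torsionLiftFil_addSeq {t t' : ℕ → (maxNilIdealC F).toIdeal} (ht0 : (t 0 : CBall F) = 0)
    (ht0' : (t' 0 : CBall F) = 0) (htp : ∀ n, mulPC W (t (n + 1)) = t n) (htp' : ∀ n, mulPC W (t' (n + 1)) = t' n) :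
    (torsionLiftFil W hθ (addSeq W t t') (coe_addSeq_zero W ht0 ht0') (mulPC_addSeq W htp htp') : BdRPlusTop F p) =
      (evalPt (BdRPlusTop.filOne F p) (MvPowerSeries.map (EisensteinRoot.CoeffDisc.toFieldCoeff D hθ) W.formalGroupLaw)
        (AinfRamXiTop.constantCoeff_map_eq_zero _ W.constantCoeff_formalGroupLaw)
        ![torsionLiftFil W hθ t ht0 htp, torsionLiftFil W hθ t' ht0' htp'] : BdRPlusTop F p) := by
  rw [coe_torsionLiftFil, torsionLift_addSeq W htp htp', addW]
  exact AinfRamXiTop.toBdR_evalPt_of_symm W.formalGroupLaw W.constantCoeff_formalGroupLaw _ _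
    (fun i => by
      fin_cases i
      · exact torsionLift_mem_span_omega W ht0 htp
      · exact torsionLift_mem_span_omega W ht0' htp')
    _ (fun i => by fin_cases i <;> rfl)

/-- **Additivity of the ω-period over the ramified base: `∫_{t ⊕ t'} ω = ∫_t ω + ∫_{t'} ω` in `B_dR⁺(F)`** for
`[p]`-compatible torsion sequences `t, t'` of `Ŵ(𝔪_{ℂ_F})`, `W` a Weierstrass equation over `𝒪_D` (AEC IV.5.2
`log_W(F(z₁,z₂)) = log_W z₁ + log_W z₂` over `F`, evaluated `ξ`-adically at `(ι_𝒪[t], ι_𝒪[t'])`, and `[t ⊕ t'] = [t] ⊕_W [t']`).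
[cite: Fontaine1982FormesDifferentielles, §5] [cite: SilvermanAEC2009, IV.5.2] -/
theorem omegaPeriod_addSeq {t t' : ℕ → (maxNilIdealC F).toIdeal} (ht0 : (t 0 : CBall F) = 0)
    (ht0' : (t' 0 : CBall F) = 0) (htp : ∀ n, mulPC W (t (n + 1)) = t n) (htp' : ∀ n, mulPC W (t' (n + 1)) = t' n) :
    omegaPeriod W hθ (addSeq W t t') (coe_addSeq_zero W ht0 ht0') (mulPC_addSeq W htp htp') =
      omegaPeriod W hθ t ht0 htp + omegaPeriod W hθ t' ht0' htp' := by
  set V := W.map (EisensteinRoot.CoeffDisc.toFieldCoeff D hθ) with hV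
  set T := torsionLiftFil W hθ t ht0 htp
  set T' := torsionLiftFil W hθ t' ht0' htp'
  have hFq : (MvPowerSeries.map (EisensteinRoot.CoeffDisc.toFieldCoeff D hθ) W.formalGroupLaw).constantCoeff = 0 :=
    AinfRamXiTop.constantCoeff_map_eq_zero _ W.constantCoeff_formalGroupLaw
  -- the point `ι_𝒪[t ⊕ t']` of `Fil¹` is `F_V(T, T')`
  have hpt : torsionLiftFil W hθ (addSeq W t t') (coe_addSeq_zero W ht0 ht0') (mulPC_addSeq W htp htp') =
      evalPt (BdRPlusTop.filOne F p) V.formalGroupLaw V.constantCoeff_formalGroupLaw ![T, T'] := by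
    apply Subtype.ext
    rw [coe_torsionLiftFil_addSeq W ht0 ht0' htp htp']
    exact congrArg Subtype.val (evalPt_congr (BdRPlusTop.filOne F p) (map_formalGroupLaw_fieldCoeff W) hFq
      V.constantCoeff_formalGroupLaw ![T, T'])
  -- `log_V(F_V(T, T')) = (log_V ∘ F_V)(T, T') = (log_V z₁ + log_V z₂)(T, T')`
  have hlog0 : PowerSeries.constantCoeff V.formalLog = 0 := V.constantCoeff_formalLog
  have hsub0 : (V.formalLog.subst V.formalGroupLaw).constantCoeff = 0 :=
    constantCoeff_subst_zero (σ := Unit) (fun _ => V.constantCoeff_formalGroupLaw) hlog0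
  have hX0 : ∀ i : Fin 2, (V.formalLog.subst (MvPowerSeries.X i : MvPowerSeries (Fin 2) (FieldCoeff hp hθ))).constantCoeff = 0 :=
    fun i => constantCoeff_subst_zero (σ := Unit) (fun _ => MvPowerSeries.constantCoeff_X i) hlog0
  have hsum0 : (V.formalLog.subst (MvPowerSeries.X 0 : MvPowerSeries (Fin 2) (FieldCoeff hp hθ)) +
      V.formalLog.subst (MvPowerSeries.X 1 : MvPowerSeries (Fin 2) (FieldCoeff hp hθ))).constantCoeff = 0 := by
    rw [map_add, hX0 0, hX0 1, add_zero]
  rw [omegaPeriod, omegaPeriod, omegaPeriod, hpt]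
  have hl : ∀ (x : (BdRPlusTop.filOne F p).toIdeal),
      (evalPt₁ (BdRPlusTop.filOne F p) (logSeries hθ W) (constantCoeff_logSeries W) x : BdRPlusTop F p) =
        evalPt₁ (BdRPlusTop.filOne F p) V.formalLog hlog0 x := fun x =>
    congrArg Subtype.val (evalPt_congr (BdRPlusTop.filOne F p) (ι := Unit) (logSeries_eq_formalLog W)
      (constantCoeff_logSeries W) hlog0 fun _ => x)
  rw [hl, hl, hl, ← evalPt₁_subst (BdRPlusTop.filOne F p) V.formalGroupLaw V.constantCoeff_formalGroupLaw V.formalLog hlog0 hsub0,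
    evalPt_congr (BdRPlusTop.filOne F p) V.formalLog_subst_formalGroupLaw hsub0 hsum0 ![T, T'], coe_evalPt, map_add,
    ← coe_evalPt (BdRPlusTop.filOne F p) _ (hX0 0), ← coe_evalPt (BdRPlusTop.filOne F p) _ (hX0 1),
    evalPt₁_subst (BdRPlusTop.filOne F p) (MvPowerSeries.X 0 : MvPowerSeries (Fin 2) (FieldCoeff hp hθ))
      (MvPowerSeries.constantCoeff_X 0) V.formalLog hlog0 (hX0 0),
    evalPt₁_subst (BdRPlusTop.filOne F p) (MvPowerSeries.X 1 : MvPowerSeries (Fin 2) (FieldCoeff hp hθ))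
      (MvPowerSeries.constantCoeff_X 1) V.formalLog hlog0 (hX0 1), evalPt_X, evalPt_X]
  rfl

end AinfRamTop

end Literature.NumberTheory.PAdicHodge

end
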